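import Summits.AtomisticToContinuum.HydrodynamicLimit.Theorems.OneFlightGossipEngineEnergyCurrentTailsWindowQuarticFloor
import HarnessLib

/-!
# The window quartic floor with the fourth cut-off moment (stub WF₄ of the line
# `quartic-schur-ledger`, crux `EnergyCurrentTails`, stmt-AtomisticToContinuum-9235)

Stub worker file for the registered stub `stub_windowQuarticFloor4` of the line lead's skeleton
`Cruxes/EnergyCurrentTails/Lines/quartic_schur_ledger.lean` (primary crux decl
`Summit.AtomisticToContinuum.HydrodynamicLimit.Theses.WarmColdDichotomy.EnergyCurrentTails`).
It is the fourth-moment, `K₀`-free companion of the landed stub WF `stub_windowQuarticFloor`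
(module `…Theorems.OneFlightGossipEngineEnergyCurrentTailsWindowQuarticFloor`), whose `K₀`-free
helpers (`windowFloor_quartic_le_add_loss`, `windowFloor_lintegral_loss_mono`) are reused verbatim.

**Statement.**  Write `λ_N = localGibbsLaw σ a₀ u₀ θ₀ N Φ`, `vᵢ(r) = (Φ.flow r z i).2`,
`y(r) = ∫ ofReal((N+1)⁻¹ ∑ᵢ ‖vᵢ(r)‖⁴) dλ_N`, `Loss(s,s'] = ∫ ofReal((N+1)⁻¹ collisionSum_{(s,s']} (Δ₄)₋/2) dλ_N`
(`Δ₄ = ‖v₁⁺‖⁴ + ‖v₂⁺‖⁴ − ‖v₁⁻‖⁴ − ‖v₂⁻‖⁴` of a collision record) and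
`M₄^{>K₀}(r) = ∫ ofReal((N+1)⁻¹ ∑ᵢ 𝟙{K₀ < ‖vᵢ(r)‖} ‖vᵢ(r)‖⁴) dλ_N`.  For continuous profiles
`a₀, θ₀ > 0`, `u₀`, reduced density `0 < σ < 1/2`, every `N`, flow `Φ`, threshold `K₀ ≥ 0` and
`0 ≤ s ≤ s'`:
`ofReal(s'−s) · y(s) ≤ ∫_{(s,s']} M₄^{>K₀}(r) dr + ofReal((s'−s)K₀⁴) + ofReal(s'−s) · Loss(s,s']`.

**Proof.**  For `r ∈ (s, s']` the landed ledger (`stub_quarticLedger`, through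
`windowFloor_quartic_le_add_loss`) gives `y(s) ≤ y(r) + Loss(s,r] ≤ y(r) + Loss(s,s']`.
Pointwise `‖v‖⁴ ≤ 𝟙{K₀<‖v‖}‖v‖⁴ + K₀⁴` (for `‖v‖ ≥ 0`; no sign condition on `K₀` is needed), so,
`λ_N` being a probability measure (`isProbabilityMeasure_localGibbsLaw`, `σ ≤ 1/2`),
`y(r) ≤ M₄^{>K₀}(r) + ofReal(K₀⁴)`; hence `y(s) ≤ M₄^{>K₀}(r) + ofReal(K₀⁴) + Loss(s,s']` for every
`r ∈ (s,s']`, and integrating `dr` over `(s, s']` (`volume (Ioc s s') = ofReal (s' − s)`, the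
constant part of the integrand is measurable) gives the claim.  Everything is in `ℝ≥0∞`; no
finiteness is needed.

References: Bobylev 1997 / Mischler–Wennberg 1999 (Povzner-type quartic bookkeeping; truncation
of moments at a velocity threshold), Cercignani–Illner–Pulvirenti 1994 §4.2.
-/

noncomputable section

open MeasureTheory Set Filter
open scoped ENNReal InnerProductSpace

namespace Summit.AtomisticToContinuum.HydrodynamicLimit.Theorems.QuarticSchurLedger

open Literature.MathematicalPhysics.KineticTheory Literature.Analysis.FluidPDE

/-! ### Elementary real inequality -/

/-- **Truncated quartic bound, fourth moment**: for `aᵢ ≥ 0` (and any real `K₀`),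
`(N+1)⁻¹ ∑ᵢ aᵢ⁴ ≤ (N+1)⁻¹ ∑ᵢ 𝟙{K₀ < aᵢ} aᵢ⁴ + K₀⁴` (termwise: `aᵢ⁴ ≤ aᵢ⁴` if `K₀ < aᵢ`,
`aᵢ⁴ ≤ K₀⁴` otherwise since `0 ≤ aᵢ ≤ K₀`; the constant averages to `K₀⁴`). [folklore] -/
theorem windowFloor4_quarticAvg_le {N : ℕ} {K₀ : ℝ} (a : Fin (N + 1) → ℝ) (ha : ∀ i, 0 ≤ a i) :
    ((N : ℝ) + 1)⁻¹ * ∑ i, a i ^ 4 ≤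
      ((N : ℝ) + 1)⁻¹ * ∑ i, (if K₀ < a i then a i ^ 4 else 0) + K₀ ^ 4 := by
  have hpt : ∀ i, a i ^ 4 ≤ (if K₀ < a i then a i ^ 4 else 0) + K₀ ^ 4 := by
    intro i
    by_cases h : K₀ < a i
    · rw [if_pos h]
      exact le_add_of_nonneg_right (by positivity)
    · rw [if_neg h]
      have h1 : a i ^ 4 ≤ K₀ ^ 4 := pow_le_pow_left₀ (ha i) (not_lt.1 h) 4
      linarith
  have hsum : ∑ i, a i ^ 4 ≤
      (∑ i, (if K₀ < a i then a i ^ 4 else 0)) + ((N : ℝ) + 1) * K₀ ^ 4 := by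
    refine (Finset.sum_le_sum fun i _ => hpt i).trans_eq ?_
    rw [Finset.sum_add_distrib, Finset.sum_const, Finset.card_univ, Fintype.card_fin, nsmul_eq_mul,
      Nat.cast_add, Nat.cast_one]
  have hN : (0 : ℝ) < (N : ℝ) + 1 := by positivity
  calc ((N : ℝ) + 1)⁻¹ * ∑ i, a i ^ 4
      ≤ ((N : ℝ) + 1)⁻¹ * ((∑ i, (if K₀ < a i then a i ^ 4 else 0)) + ((N : ℝ) + 1) * K₀ ^ 4) :=
        mul_le_mul_of_nonneg_left hsum (inv_nonneg.2 hN.le)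
    _ = _ := by rw [mul_add, ← mul_assoc, inv_mul_cancel₀ hN.ne', one_mul]

/-! ### Integrated bound under a probability law -/

section Torus

variable {N : ℕ} {ε : ℝ}

/-- **Truncated fourth moment bound, integrated**: under a probability law,
`∫ ofReal((N+1)⁻¹∑ᵢ‖vᵢ(r)‖⁴) ≤ ∫ ofReal((N+1)⁻¹∑ᵢ 𝟙{K₀<‖vᵢ(r)‖}‖vᵢ(r)‖⁴) + ofReal(K₀⁴)`
(`windowFloor4_quarticAvg_le` pointwise, `lintegral_mono`, mass one). [folklore] -/
theorem windowFloor4_lintegral_quartic_le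
    (Φ : HardSphereFlow (Torus.geometry (Fin 3)) ε (N + 1))
    (μ : Measure (Config (N + 1) (Fin 3) T3)) [IsProbabilityMeasure μ] (r K₀ : ℝ) :
    (∫⁻ z, ENNReal.ofReal (((N : ℝ) + 1)⁻¹ * ∑ i : Fin (N + 1), ‖(Φ.flow r z i).2‖ ^ 4) ∂μ) ≤
      (∫⁻ z, ENNReal.ofReal (((N : ℝ) + 1)⁻¹ *
          ∑ i : Fin (N + 1), (if K₀ < ‖(Φ.flow r z i).2‖ then ‖(Φ.flow r z i).2‖ ^ 4 else 0)) ∂μ) +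
        ENNReal.ofReal (K₀ ^ 4) := by
  have hc : (0 : ℝ) ≤ ((N : ℝ) + 1)⁻¹ := by positivity
  have hC : Measurable fun _ : Config (N + 1) (Fin 3) T3 => ENNReal.ofReal (K₀ ^ 4) :=
    measurable_const
  calc (∫⁻ z, ENNReal.ofReal (((N : ℝ) + 1)⁻¹ * ∑ i : Fin (N + 1), ‖(Φ.flow r z i).2‖ ^ 4) ∂μ)
      ≤ ∫⁻ z, (ENNReal.ofReal (((N : ℝ) + 1)⁻¹ *
          ∑ i : Fin (N + 1), (if K₀ < ‖(Φ.flow r z i).2‖ then ‖(Φ.flow r z i).2‖ ^ 4 else 0)) +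
          ENNReal.ofReal (K₀ ^ 4)) ∂μ := by
        refine lintegral_mono fun z => ?_
        have h4 : 0 ≤ ((N : ℝ) + 1)⁻¹ *
            ∑ i : Fin (N + 1), (if K₀ < ‖(Φ.flow r z i).2‖ then ‖(Φ.flow r z i).2‖ ^ 4 else 0) :=
          mul_nonneg hc (Finset.sum_nonneg fun i _ => by split_ifs <;> positivity)
        rw [← ENNReal.ofReal_add h4 (by positivity)]
        exact ENNReal.ofReal_le_ofReal
          (windowFloor4_quarticAvg_le (fun i => ‖(Φ.flow r z i).2‖) fun i => norm_nonneg _)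
    _ = _ := by rw [lintegral_add_right _ hC, lintegral_const, measure_univ, mul_one]

end Torus

/-! ### Assembly in `ℝ≥0∞` -/

/-- One `r`-slice of the fourth-moment window floor: from `Y ≤ Y_r + L` and `Y_r ≤ M + G₄`,
`Y ≤ M + (G₄ + L)` in `ℝ≥0∞`. [folklore] -/
theorem windowFloor4_slice {Y Yr L M G₄ : ℝ≥0∞} (h1 : Y ≤ Yr + L) (h2 : Yr ≤ M + G₄) :
    Y ≤ M + (G₄ + L) := by
  calc Y ≤ Yr + L := h1
    _ ≤ (M + G₄) + L := add_le_add h2 le_rfl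
    _ = M + (G₄ + L) := add_assoc _ _ _

/-- **Integration of the slices over the window (fourth moment)**: if
`Y ≤ M₄(r) + (ofReal(K₀⁴) + L)` for every `r ∈ (s, s']` (`s ≤ s'`), then
`ofReal(s'−s) · Y ≤ ∫_{(s,s']} M₄ + ofReal((s'−s)K₀⁴) + ofReal(s'−s) · L`
(`setLIntegral_const`, `Real.volume_Ioc`, `setLIntegral_mono'`, `lintegral_add_right` with the
measurable constant part; `M₄` need not be measurable). [folklore] -/
theorem windowFloor4_assembly {Y L : ℝ≥0∞} {M₄ : ℝ → ℝ≥0∞} {K₀ s s' : ℝ}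
    (hss' : s ≤ s')
    (hpt : ∀ r ∈ Ioc s s', Y ≤ M₄ r + (ENNReal.ofReal (K₀ ^ 4) + L)) :
    ENNReal.ofReal (s' - s) * Y ≤
      (∫⁻ r in Ioc s s', M₄ r) + ENNReal.ofReal ((s' - s) * K₀ ^ 4) +
        ENNReal.ofReal (s' - s) * L := by
  have hvol : volume (Ioc s s') = ENNReal.ofReal (s' - s) := Real.volume_Ioc
  have hd : 0 ≤ s' - s := sub_nonneg.2 hss'
  have hC : Measurable fun _ : ℝ => ENNReal.ofReal (K₀ ^ 4) + L := measurable_const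
  calc ENNReal.ofReal (s' - s) * Y
      = ∫⁻ _ in Ioc s s', Y := by
        rw [setLIntegral_const, hvol, mul_comm]
    _ ≤ ∫⁻ r in Ioc s s', (M₄ r + (ENNReal.ofReal (K₀ ^ 4) + L)) :=
        setLIntegral_mono' measurableSet_Ioc hpt
    _ = (∫⁻ r in Ioc s s', M₄ r) + (ENNReal.ofReal (K₀ ^ 4) + L) * volume (Ioc s s') := by
        rw [lintegral_add_right _ hC, setLIntegral_const]
    _ = _ := by
        rw [hvol, ENNReal.ofReal_mul (q := K₀ ^ 4) hd]
        ring

/-- **Stub WF₄ — THE WINDOW QUARTIC FLOOR WITH THE FOURTH MOMENT** (line `quartic-schur-ledger`,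
crux stmt-AtomisticToContinuum-9235, `EnergyCurrentTails`; glue, the fourth-moment companion of the
landed WF `stub_windowQuarticFloor`).  For `0 < σ < 1/2` (so that `λ_N` is a probability measure
and the landed ledger L applies), every `N`, flow `Φ`, threshold `K₀ ≥ 0` and `0 ≤ s ≤ s′`:
`(s′−s) · y(s) ≤ ∫_s^{s′} M₄^{>K₀}(r) dr + (s′−s)K₀⁴ + (s′−s) · Loss(s,s′]`.
Proof: for `r ∈ (s,s′]` the ledger L (`stub_quarticLedger`) gives
`y(s) ≤ y(r) + Loss(s,r] ≤ y(r) + Loss(s,s′]` (`Gain ≥ 0`; the loss is monotone in the window,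
`windowFloor_quartic_le_add_loss`); pointwise `‖v‖⁴ ≤ 𝟙{‖v‖>K₀}‖v‖⁴ + K₀⁴`, so
`y(s) ≤ M₄^{>K₀}(r) + K₀⁴ + Loss(s,s′]` (mass one, `windowFloor4_lintegral_quartic_le`); integrate
`dr` over `(s,s′]` (`windowFloor4_assembly`). [folklore] -/
theorem stub_windowQuarticFloor4 :
    ∀ (a₀ θ₀ : T3 → ℝ) (u₀ : T3 → V3), Continuous a₀ → Continuous θ₀ → Continuous u₀ →
        (∀ x, 0 < a₀ x) → (∀ x, 0 < θ₀ x) →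
        ∀ σ : ℝ, 0 < σ → σ < 1 / 2 →
          ∀ (N : ℕ) (Φ : HardSphereFlow (Torus.geometry (Fin 3)) (hsDiameter σ N) (N + 1)) (K₀ : ℝ),
            0 ≤ K₀ → ∀ s s' : ℝ, 0 ≤ s → s ≤ s' →
              ENNReal.ofReal (s' - s) *
                  (∫⁻ z, ENNReal.ofReal (((N : ℝ) + 1)⁻¹ *
                      ∑ i : Fin (N + 1), ‖(Φ.flow s z i).2‖ ^ 4)
                    ∂(localGibbsLaw σ a₀ u₀ θ₀ N Φ))
                ≤ (∫⁻ r in Set.Ioc s s',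
                    (∫⁻ z, ENNReal.ofReal (((N : ℝ) + 1)⁻¹ *
                        ∑ i : Fin (N + 1), (if K₀ < ‖(Φ.flow r z i).2‖ then
                          ‖(Φ.flow r z i).2‖ ^ 4 else 0))
                      ∂(localGibbsLaw σ a₀ u₀ θ₀ N Φ))) +
                  ENNReal.ofReal ((s' - s) * K₀ ^ 4) +
                  ENNReal.ofReal (s' - s) *
                    (∫⁻ z, ENNReal.ofReal (((N : ℝ) + 1)⁻¹ *
                        Φ.collisionSum (Set.Ioc s s')
                          (fun col => max (‖col.preVel.1‖ ^ 4 + ‖col.preVel.2‖ ^ 4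
                            - ‖col.postVel.1‖ ^ 4 - ‖col.postVel.2‖ ^ 4) 0 / 2) z)
                      ∂(localGibbsLaw σ a₀ u₀ θ₀ N Φ)) := by
  intro a₀ θ₀ u₀ ha hθ hu ha0 hθ0 σ hσ hσ2 N Φ K₀ _ s s' hs hss'
  haveI := isProbabilityMeasure_localGibbsLaw ha hθ hu ha0 hθ0 hσ2.le N Φ
  refine windowFloor4_assembly hss' fun r hr => ?_
  exact windowFloor4_slice
    (windowFloor_quartic_le_add_loss a₀ θ₀ u₀ hσ hσ2 N Φ hs hr.1.le hr.2)
    (windowFloor4_lintegral_quartic_le Φ (localGibbsLaw σ a₀ u₀ θ₀ N Φ) r K₀)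

end Summit.AtomisticToContinuum.HydrodynamicLimit.Theorems.QuarticSchurLedger

end
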